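import Summits.BirchSwinnertonDyer.BirchSwinnertonDyer.Theorems.ClassRecordThreeEulerHalvesAtThreeChebSupplyGL2
import Summits.BirchSwinnertonDyer.BirchSwinnertonDyer.Theorems.ClassRecordThreeEulerHalvesAtThreeChebSupplyKummerGenerator
import Literature.NumberTheory.GaloisRepresentations.ImaginaryQuadraticCyclotomicProofs
import Literature.NumberTheory.EllipticCurves.CMTorsionIrreducibleOrdinaryProofs
import Mathlib.LinearAlgebra.Trace
import HarnessLib

/-!
# The Chebotarev class of `stub_chebotarevSupplyAtThree` is non-empty (crux 19109, line `inert`;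
# STUB-PLAN part C2): `σ₀ = c₀ · ã^j · [x̃, ỹ]`

Crux `stmt-BirchSwinnertonDyer-19109` (`EulerHalvesAtThree`), line `inert` (tam3-p1 g18, skeleton r19),
registered stub `stub_chebotarevSupplyAtThree` (the CHEBOTAREV SUPPLY).  Its proof (STUB-PLAN, evidence on
the item) has three parts: GLUE (the Kummer datum `γ₀` of the generator `β`), NON-EMPTINESS of the
Frobenius class in `M = K(μ_{3^E}, E[3], γ₀^{1/3})/ℚ`, and the DICTIONARY (Frobenius ⟹ inert, `3^E ∣ ℓ+1`,
`3 ∤ a_ℓ`, order condition) with Frobenius density.  This file proves the NON-EMPTINESS inside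
`Γ_ℚ = Gal(ℚ̄/ℚ)` acting on `ℚ̄`: with `e = absEmbedding ℚ K`, `res(Γ_K) = Gal(ℚ̄/e(K))`, and
`ρ̄_{E,3} = galoisRepTorsion W 3` on the `F_3`-plane `E[3] = geomTorsion W 3`:

* `exists_frobeniusClass_elt` — **the element `σ₀`** with `σ₀ ∉ Gal(ℚ̄/e(K))`, `σ₀ ζ = ζ⁻¹`,
  `σ₀ ω = ω⁻¹`, `tr ρ̄_{E,3}(σ₀) ≠ 0`, `σ₀² c ≠ c`, under `Surj W 3`, `[K:ℚ] = 2`, `K` totally complex,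
  `#𝒪_K^× = 2`, `γ₀` a non-cube inverted by the non-trivial automorphism of `K`, `c³ = e(γ₀)`.

Inputs: p649893 `…ChebSupplyGL2` (the `GL₂(F_3)` game and the commutator stock), p650478
`…ChebSupplyRoots` (action algebra), `…ChebSupplyKummerGenerator` (the Kummer generator `ã`), the tree's
`AbsGaloisOuterConj`, `Rat.not_mem_range_absGaloisRestrict_of_isComplexConjugation`,
`exists_isComplexConjugation`, `finrank_zmod_geomTorsion_eq_two`.  HONEST FRAMING: one of three parts of
one registered stub of one line of crux 19109; nothing about BSD for any curve is proved here.

## References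

* J.-P. Serre, *Propriétés galoisiennes des points d'ordre fini des courbes elliptiques*, Invent. Math. 15
  (1972), §2. [Serre1972]
* J. Neukirch, *Algebraic Number Theory* (1999), Ch. IV §1. [NeukirchANT1999]

## Mathlib / tree search

Tree: `absEmbedding_absGaloisQuot_apply`, `absGaloisQuot_eq_one_iff`,
`mem_range_absGaloisRestrict_iff_smul_absEmbedding` (`AbsGaloisOuterConj`); `exists_isComplexConjugation`,
`IsComplexConjugation.sq_eq_one` (`AbsGaloisGroup`); `Rat.not_mem_range_absGaloisRestrict_of_isComplexConjugation`
(`ImaginaryQuadraticCyclotomicProofs`); `galoisRepTorsion`, `galoisRepTorsion_apply`,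
`HasSurjectiveModNGaloisRep`, `finite_torsionPoints_holds`, `finrank_zmod_geomTorsion_eq_two`;
`ChebSupply.exists_stock_trace_ne_zero_end`, `stockᵢ_eq_comm` (p649893), `ChebSupply.*` (p650478).
Mathlib: `Module.finBasisOfFinrankEq`, `Matrix.toLin_mul`, `Matrix.toLin_one`, `LinearEquiv.ofLinear`,
`pow_card_eq_one'`, `IsGalois.card_aut_eq_finrank`, `AddMonoidHom.coe_toZModLinearMap`.
-/

noncomputable section

set_option autoImplicit false
set_option linter.dupNamespace false

open scoped NumberField
open Field Polynomial Literature.NumberTheory.GaloisRepresentations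

namespace Summit.BirchSwinnertonDyer.BirchSwinnertonDyer.Theorems.ChebSupply

variable {K : Type} [Field K] [NumberField K]

/-! ## §3 The element `σ₀` -/

open WeierstrassCurve in
/-- **The Chebotarev class of `stub_chebotarevSupplyAtThree` is NON-EMPTY** (STUB-PLAN (C2)): for
`W/ℚ` with `ρ̄_{E,3}` onto, `K` imaginary quadratic (`[K:ℚ] = 2`, totally complex, `#𝒪_K^× = 2`),
`γ₀ ∈ K` a non-cube inverted by the non-trivial automorphism of `K`, `c³ = e(γ₀)`, `ω` a primitive cube
root and `ζ` a primitive `n`-th root of unity in `ℚ̄`, there is `σ₀ ∈ Γ_ℚ` with: `σ₀ ∉ Gal(ℚ̄/e(K))`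
(acts on `K` as complex conjugation), `σ₀ ζ = ζ⁻¹`, `σ₀ ω = ω⁻¹`, `tr ρ̄_{E,3}(σ₀) ≠ 0` on the
`F_3`-plane `E[3]`, and `σ₀² c ≠ c`.  Construction `σ₀ = c₀ · ã^j · [x̃, ỹ]`: `c₀` a complex
conjugation (`exists_isComplexConjugation`; inverts roots of unity and `c`), `ã` the Kummer generator
(`exists_mem_range_smul_eq_omega_mul`), `x̃, ỹ` lifts under the surjective `ρ̄_{E,3}` of a commutator
pair for a stock matrix `s` (`ChebSupply.stockᵢ_eq_comm`), chosen with `j` by the `GL₂(F_3)` game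
(`ChebSupply.exists_stock_trace_ne_zero_end`: two of `tr(r u^j s)`, `j = 0,1,2`, are non-zero, and only
one `j` has `3 ∣ j + i` where `[x̃, ỹ] c = ω^i c`); then `tr ρ̄(σ₀) = tr(r u^j s) ≠ 0` and
`σ₀² c = ω^{2(j+i)} c ≠ c` (`sq_smul_eq_pow_mul`).  NO hypothesis on `ρ_{E,9}` and NO Kummer
independence from `E[3]` is used. [cite: Serre1972, §2] [cite: NeukirchANT1999, Ch. IV §1] -/
theorem exists_frobeniusClass_elt (W : WeierstrassCurve ℚ) [W.IsElliptic]
    (hsurj : W.HasSurjectiveModNGaloisRep ((3 : ℕ) : ℤ))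
    (h2 : Module.finrank ℚ K = 2) (hKc : NumberField.IsTotallyComplex K) (hunits : Nat.card (𝓞 K)ˣ = 2)
    {γ₀ : K} (hγ : ∀ z : K, z ^ 3 ≠ γ₀) (hτ : ∀ τ : K ≃ₐ[ℚ] K, τ ≠ 1 → τ γ₀ = γ₀⁻¹)
    {ω ζ c : AlgebraicClosure ℚ} (hω : IsPrimitiveRoot ω 3) {n : ℕ} (hζ : IsPrimitiveRoot ζ n)
    (hn : 0 < n) (hc : c ^ 3 = absEmbedding ℚ K γ₀) :
    ∃ σ₀ : absoluteGaloisGroup ℚ, σ₀ ∉ (absGaloisRestrict ℚ K).range ∧ σ₀ • ζ = ζ⁻¹ ∧ σ₀ • ω = ω⁻¹ ∧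
      (letI : Module (ZMod 3) (geomTorsion W ((3 : ℕ) : ℤ)) := AddSubgroup.torsionBy.zmodModule
       LinearMap.trace (ZMod 3) (geomTorsion W ((3 : ℕ) : ℤ))
          ((galoisRepTorsion W ((3 : ℕ) : ℤ) σ₀).toAdd.toAddMonoidHom.toZModLinearMap 3) ≠ 0) ∧
      σ₀ • (σ₀ • c) ≠ c := by
  letI : Module (ZMod 3) (geomTorsion W ((3 : ℕ) : ℤ)) := AddSubgroup.torsionBy.zmodModule
  haveI : Algebra.IsQuadraticExtension ℚ K := ⟨h2⟩
  set ι := absEmbedding ℚ K with hιdef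
  have hγ0 : γ₀ ≠ 0 := fun h => hγ 0 (by rw [h]; ring)
  have hιγ : ι γ₀ ≠ 0 := (map_ne_zero ι).mpr hγ0
  have hc0 : c ≠ 0 := fun h => hιγ (by rw [← hc, h]; ring)
  have hω0 : ω ≠ 0 := hω.ne_zero (by norm_num)
  have hω3 : ω ^ 3 = 1 := hω.pow_eq_one
  -- complex conjugation
  obtain ⟨c₀, hc₀⟩ := exists_isComplexConjugation (Rat.castHom ℝ)
  have hc₀r : c₀ ∉ (absGaloisRestrict ℚ K).range :=
    Rat.not_mem_range_absGaloisRestrict_of_isComplexConjugation K hKc hc₀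
  have hc₀2 : c₀ * c₀ = 1 := by rw [← pow_two]; exact hc₀.sq_eq_one
  have hinv : ∀ x : AlgebraicClosure ℚ, c₀ • (c₀ • x) = x := fun x => by rw [← mul_smul, hc₀2, one_smul]
  have hc₀ω : c₀ • ω = ω⁻¹ := smul_eq_inv_of_pow_eq_one hc₀ (by norm_num) hω3
  have hc₀ζ : c₀ • ζ = ζ⁻¹ := smul_eq_inv_of_pow_eq_one hc₀ hn.ne' hζ.pow_eq_one
  have hquot : absGaloisQuot ℚ K c₀ ≠ 1 := fun h => hc₀r ((absGaloisQuot_eq_one_iff ℚ K c₀).mp h)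
  have hc₀γ : c₀ • ι γ₀ = (ι γ₀)⁻¹ := by
    rw [hιdef, ← absEmbedding_absGaloisQuot_apply, hτ _ hquot, map_inv₀]
  have hc₀c : c₀ • c = c⁻¹ := smul_eq_inv_of_involutive hιγ hc hc₀γ hinv
    (fun u hu => smul_eq_inv_of_pow_eq_one hc₀ (by norm_num) hu)
  -- the Kummer generator
  obtain ⟨a, har, haζ, haω, hac⟩ := exists_mem_range_smul_eq_omega_mul h2 hunits hc₀ hγ hc₀γ hω hζ hn hc
  -- the mod-3 representation as a monoid hom to `End(E[3])`
  let V := geomTorsion W ((3 : ℕ) : ℤ)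
  let F : absoluteGaloisGroup ℚ →* Module.End (ZMod 3) V :=
    { toFun := fun σ => (galoisRepTorsion W ((3 : ℕ) : ℤ) σ).toAdd.toAddMonoidHom.toZModLinearMap 3
      map_one' := LinearMap.ext fun x => by
        simp [AddMonoidHom.coe_toZModLinearMap]
      map_mul' := fun σ τ => LinearMap.ext fun x => by
        simp [AddMonoidHom.coe_toZModLinearMap, galoisRepTorsion_apply] }
  have hF : ∀ σ (x : V), F σ x = σ • x := fun σ x => rfl
  haveI : Finite V := finite_torsionPoints_holds W (AlgebraicClosure ℚ) (n := 3) (by norm_num)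
  haveI : Module.Finite (ZMod 3) V := Module.Finite.of_finite
  have hfr : Module.finrank (ZMod 3) V = 2 := W.finrank_zmod_geomTorsion_eq_two 3
  let bT : Module.Basis (Fin 2) (ZMod 3) V := Module.finBasisOfFinrankEq (ZMod 3) V hfr
  -- `R = F c₀` is an involution, `U = F a` is invertible
  have hR : F c₀ * F c₀ = 1 := by rw [← map_mul, hc₀2, map_one]
  have hU : LinearMap.det (F a) ≠ 0 := by
    intro h0
    have h1 : LinearMap.det (F a) * LinearMap.det (F a⁻¹) = 1 := by
      rw [← map_mul, ← map_mul, mul_inv_cancel, map_one, map_one]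
    rw [h0, zero_mul] at h1
    exact zero_ne_one h1
  -- realising matrices: for `X X'` inverse to each other, some `x` has `F x = toLin X`, `F x⁻¹ = toLin X'`
  have hreal : ∀ X X' : Matrix (Fin 2) (Fin 2) (ZMod 3), X * X' = 1 → X' * X = 1 →
      ∃ x : absoluteGaloisGroup ℚ, F x = Matrix.toLin bT bT X ∧ F x⁻¹ = Matrix.toLin bT bT X' := by
    intro X X' h1 h2
    have h1' : Matrix.toLin bT bT X ∘ₗ Matrix.toLin bT bT X' = LinearMap.id := by
      rw [← Matrix.toLin_mul bT bT bT, h1, Matrix.toLin_one]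
    have h2' : Matrix.toLin bT bT X' ∘ₗ Matrix.toLin bT bT X = LinearMap.id := by
      rw [← Matrix.toLin_mul bT bT bT, h2, Matrix.toLin_one]
    let eX : V ≃ₗ[ZMod 3] V := LinearEquiv.ofLinear (Matrix.toLin bT bT X) (Matrix.toLin bT bT X') h1' h2'
    obtain ⟨x, hx⟩ := hsurj (Multiplicative.ofAdd eX.toAddEquiv)
    have hFx : F x = Matrix.toLin bT bT X := by
      refine LinearMap.ext fun v => ?_
      rw [hF, ← galoisRepTorsion_apply, hx]
      rfl
    refine ⟨x, hFx, ?_⟩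
    have h3 : F x⁻¹ * F x = 1 := by rw [← map_mul, inv_mul_cancel, map_one]
    calc F x⁻¹ = F x⁻¹ * (Matrix.toLin bT bT X * Matrix.toLin bT bT X') := by
            rw [show Matrix.toLin bT bT X * Matrix.toLin bT bT X' = 1 from h1', mul_one]
      _ = (F x⁻¹ * F x) * Matrix.toLin bT bT X' := by rw [hFx, mul_assoc]
      _ = Matrix.toLin bT bT X' := by rw [h3, one_mul]
  -- commutators of `Γ_ℚ` fix `K` (the group `Gal(K/ℚ)` of order `2` is commutative)
  have hcommK : ∀ x y : absoluteGaloisGroup ℚ, x * y * x⁻¹ * y⁻¹ ∈ (absGaloisRestrict ℚ K).range := by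
    intro x y
    rw [← absGaloisQuot_eq_one_iff, map_mul, map_mul, map_mul, map_inv, map_inv]
    have hcard : Nat.card (K ≃ₐ[ℚ] K) = 2 := by rw [IsGalois.card_aut_eq_finrank, h2]
    have hsq' : ∀ g : K ≃ₐ[ℚ] K, g * g = 1 := fun g => by
      rw [← pow_two, ← hcard]; exact pow_card_eq_one'
    have hsq : ∀ g : K ≃ₐ[ℚ] K, g⁻¹ = g := fun g => inv_eq_of_mul_eq_one_right (hsq' g)
    rw [hsq, hsq, mul_assoc (absGaloisQuot ℚ K x * absGaloisQuot ℚ K y)]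
    exact hsq' _
  -- every element of the range acts on `c` by a cube root of unity
  have hrange := fun g => mem_range_absGaloisRestrict_iff_smul_absEmbedding ℚ K g
  have hcube : ∀ g ∈ (absGaloisRestrict ℚ K).range, ∃ i < 3, g • c = ω ^ i * c := fun g hg =>
    eq_mul_pow_of_pow_three_eq hω hc0 (by rw [← smul_pow', hc, (hrange g).mp hg])
  -- the finishing move, for a stock matrix `S = X Y X' Y'`
  have hstock : ∀ S X X' Y Y' : Matrix (Fin 2) (Fin 2) (ZMod 3),
      X * Y * X' * Y' = S → X * X' = 1 → X' * X = 1 → Y * Y' = 1 → Y' * Y = 1 →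
      ((LinearMap.trace (ZMod 3) V (F c₀ * Matrix.toLin bT bT S) ≠ 0 ∧
          LinearMap.trace (ZMod 3) V (F c₀ * F a * Matrix.toLin bT bT S) ≠ 0) ∨
        (LinearMap.trace (ZMod 3) V (F c₀ * Matrix.toLin bT bT S) ≠ 0 ∧
          LinearMap.trace (ZMod 3) V (F c₀ * F a * F a * Matrix.toLin bT bT S) ≠ 0) ∨
        (LinearMap.trace (ZMod 3) V (F c₀ * F a * Matrix.toLin bT bT S) ≠ 0 ∧
          LinearMap.trace (ZMod 3) V (F c₀ * F a * F a * Matrix.toLin bT bT S) ≠ 0)) →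
      ∃ σ₀ : absoluteGaloisGroup ℚ, σ₀ ∉ (absGaloisRestrict ℚ K).range ∧ σ₀ • ζ = ζ⁻¹ ∧ σ₀ • ω = ω⁻¹ ∧
        LinearMap.trace (ZMod 3) V (F σ₀) ≠ 0 ∧ σ₀ • (σ₀ • c) ≠ c := by
    intro S X X' Y Y' hS hXX' hX'X hYY' hY'Y htr
    obtain ⟨x, hx, hx'⟩ := hreal X X' hXX' hX'X
    obtain ⟨y, hy, hy'⟩ := hreal Y Y' hYY' hY'Y
    -- the commutator `h`
    have hFh : F (x * y * x⁻¹ * y⁻¹) = Matrix.toLin bT bT S := by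
      rw [map_mul, map_mul, map_mul, hx, hy, hx', hy', ← hS, Matrix.toLin_mul bT bT bT,
        Matrix.toLin_mul bT bT bT, Matrix.toLin_mul bT bT bT]
      rfl
    have hhr := hcommK x y
    have hhζ : (x * y * x⁻¹ * y⁻¹) • ζ = ζ := commutator_smul_eq_self_of_isPrimitiveRoot hζ hn x y
    have hhω : (x * y * x⁻¹ * y⁻¹) • ω = ω :=
      commutator_smul_eq_self_of_isPrimitiveRoot hω (by norm_num) x y
    obtain ⟨i, hi3, hhi⟩ := hcube _ hhr
    -- finishing with `σ₀ = c₀ a^j h` once `j` is chosen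
    have finish : ∀ j : ℕ, LinearMap.trace (ZMod 3) V (F c₀ * F a ^ j * Matrix.toLin bT bT S) ≠ 0 →
        ¬ 3 ∣ j + i →
        ∃ σ₀ : absoluteGaloisGroup ℚ, σ₀ ∉ (absGaloisRestrict ℚ K).range ∧ σ₀ • ζ = ζ⁻¹ ∧
          σ₀ • ω = ω⁻¹ ∧ LinearMap.trace (ZMod 3) V (F σ₀) ≠ 0 ∧ σ₀ • (σ₀ • c) ≠ c := by
      intro j hj hji
      refine ⟨c₀ * a ^ j * (x * y * x⁻¹ * y⁻¹), ?_, ?_, ?_, ?_, ?_⟩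
      · intro hmem
        apply hc₀r
        have hrest : a ^ j * (x * y * x⁻¹ * y⁻¹) ∈ (absGaloisRestrict ℚ K).range :=
          Subgroup.mul_mem _ (Subgroup.pow_mem _ har j) hhr
        have heq : c₀ = c₀ * a ^ j * (x * y * x⁻¹ * y⁻¹) * (a ^ j * (x * y * x⁻¹ * y⁻¹))⁻¹ := by group
        rw [heq]
        exact Subgroup.mul_mem _ hmem (Subgroup.inv_mem _ hrest)
      · rw [mul_smul, mul_smul, hhζ, pow_smul_eq_self haζ, hc₀ζ]
      · rw [mul_smul, mul_smul, hhω, pow_smul_eq_self haω, hc₀ω]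
      · rw [MonoidHom.map_mul F, MonoidHom.map_mul F, MonoidHom.map_pow F, hFh]
        exact hj
      · rw [sq_smul_eq_pow_mul hc₀c hc₀ω (pow_smul_eq_pow_mul hac haω j) (pow_smul_eq_self haω j)
          hhi hhω, Ne, pow_mul_eq_self_iff hω hc0]
        exact hji
    -- choose `j`
    interval_cases i
    · rcases htr with ⟨-, h1⟩ | ⟨-, h2⟩ | ⟨h1, -⟩
      · exact finish 1 (by rwa [pow_one]) (by norm_num)
      · exact finish 2 (by rwa [pow_two, ← mul_assoc]) (by norm_num)
      · exact finish 1 (by rwa [pow_one]) (by norm_num)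
    · rcases htr with ⟨h0, -⟩ | ⟨h0, -⟩ | ⟨h1, -⟩
      · exact finish 0 (by rwa [pow_zero, mul_one]) (by norm_num)
      · exact finish 0 (by rwa [pow_zero, mul_one]) (by norm_num)
      · exact finish 1 (by rwa [pow_one]) (by norm_num)
    · rcases htr with ⟨h0, -⟩ | ⟨h0, -⟩ | ⟨-, h2⟩
      · exact finish 0 (by rwa [pow_zero, mul_one]) (by norm_num)
      · exact finish 0 (by rwa [pow_zero, mul_one]) (by norm_num)
      · exact finish 2 (by rwa [pow_two, ← mul_assoc]) (by norm_num)
  -- the `GL₂(F_3)` game picks the stock matrix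
  rcases exists_stock_trace_ne_zero_end bT (F c₀) (F a) hR hU with h | h | h
  · obtain ⟨hS, hXX', hYY', hY'Y⟩ := stock₁_eq_comm
    exact hstock _ _ _ _ _ hS hXX' hXX' hYY' hY'Y h
  · obtain ⟨hS, hXX', hYY', hY'Y⟩ := stock₂_eq_comm
    exact hstock _ _ _ _ _ hS hXX' hXX' hYY' hY'Y h
  · obtain ⟨hS, hXX', hX'X, hYY', hY'Y⟩ := stock₃_eq_comm
    exact hstock _ _ _ _ _ hS hXX' hX'X hYY' hY'Y h

end Summit.BirchSwinnertonDyer.BirchSwinnertonDyer.Theorems.ChebSupply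

end
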